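import Literature.MathematicalPhysics.QuantumLattice.HubbardUVSymbolCTDifferences
import Literature.Probability.LatticeModels.TorusAdditiveWeightSum
import HarnessLib

/-!
# The decay constant of the scale-`0` covariance of the counterterm carrier on the time grid: every row and every column sum of
# `Sᵀ C^K_{>Λ} S` is bounded, uniformly in the Matsubara cutoff (de Siqueira Pedra–Salmhofer's `α_C`, BGM's `L¹` norm of the UV propagator)

Topic `MathematicalPhysics/QuantumLattice`; cell gate-hubbard-kl, crux K3 child ENGINE (`KLRegimeEngineV11`), stub `stub_engine_scale0`, input (I6):
the hypotheses `hrow`/`hcol` (`∀ X, Σ_Y ‖C X Y‖ ≤ α`) of `GrassmannEffectiveActionBoundDB.sum_norm_kernel_effAction_le_of_gramBounded` for the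
scale-`0` covariance `C = (hubbardGridSub L M β N)ᵀ · hubbardCovAboveCT L M β μ 0 K Λ · hubbardGridSub L M β N` on the `N`-point time grid
(`2 ≤ M`, `2M ≤ N`), next to its determinant constant (`HubbardCTScaleZeroDetBound`).  Assembly of tree lemmas:
`HubbardGridCharacters.sum_norm_gridSub_pullback_row_le/col_le` (row sums ≤ the `ℓ¹` norm of the padded symbol's character sum),
`TorusFourierWeightedL1Prod.sum_sum_norm_prodChar_le` (weighted Plancherel with two differences and the additive weight
`1 + c_T(4|ã|/N)⁴ + Σ_l c_X(4|b̃_l|/L)⁴`, `c_T = (N s₀/4)⁴`, `c_X = (L/4)⁴`), `TorusAdditiveWeightSum.sum_inv_additiveWeight_le`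
(`Σ W⁻¹ ≤ (2 + 12/s₀)·14²`) and the three `ℓ²` sums of `HubbardUVSymbolCTDifferences`.  The result (`rowSum_gridSub_hubbardCovAboveCT_le`,
`colSum_…`) is explicit in `β, L, M, N, Λ, s₀`, the cutoff-derivative bounds `B₁, B₂` and the line bound `D` of the frame band; multiplied by the
grid weight `β/N` of the local quartic vertex and read at `s₀ = βΛ/N` it is `O(1)` uniformly in `M ≥ β³`, `β ≥ 1`, `L` (the Summits-side corollary).

Everything is proved; no definitions, no named facts.

## Sources

W. de Siqueira Pedra, M. Salmhofer, Comm. Math. Phys. 282 (2008) 797–818, §4 Cor. 4.4 and Thm 4.5 (`α_C`, `ω_C = 2α_C δ_C^{-2}`) (`PedraSalmhofer2008`);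
G. Benfatto, A. Giuliani, V. Mastropietro, Ann. Henri Poincaré 7 (2006) 809–898, §2.8 (2.80)–(2.81), App. A1 (`BenfattoGiulianiMastropietro2006`).
-/

noncomputable section

namespace Literature.MathematicalPhysics.QuantumLattice

open Literature.Probability.LatticeModels Finset Complex

variable {L M N : ℕ} [NeZero L] [NeZero N]

/-- **The `ℓ¹` norm of the character sum of the padded ultraviolet symbol** (the quantity `A` of `sum_norm_gridSub_pullback_row_le`):
weighted Plancherel with the additive quartic weight at time rate `s₀` and unit space rate, the weight sum `≤ (2+12/s₀)·14²`, and the three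
`ℓ²` sums of `HubbardUVSymbolCTDifferences`. [cite: BenfattoGiulianiMastropietro2006, §2.8 (2.80)-(2.81)] -/
theorem sum_sum_norm_charSum_gridSymbol_uvSymbolCT_le {β μ Λ : ℝ} {K : TrigPolyC4v} (hβ : 0 < β) (hΛ : 0 < Λ) {B₁ B₂ : ℝ}
    (hB₁ : ∀ x, |deriv salmhoferCutoff x| ≤ B₁) (hB₂ : ∀ x, |deriv (deriv salmhoferCutoff) x| ≤ B₂) {D : ℝ} (hD : 0 ≤ D)
    (hline : UVLineBound μ K D) (hM : 2 ≤ M) (hMN : 2 * M ≤ N) {s₀ : ℝ} (hs₀ : 0 < s₀) (σ : Fin 2) :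
    ∑ a : TorusSite 1 N, ∑ bv : TorusSite 2 L,
        ‖∑ q₀ : TorusSite 1 N, ∑ qv : TorusSite 2 L, torusChar q₀ a * torusChar qv bv * gridSymbol L M N β (uvSymbolCT L M β μ K Λ) σ q₀ qv‖ ≤
      Real.sqrt ((2 + 12 / s₀) * 14 ^ 2) *
        Real.sqrt ((N : ℝ) ^ 1 * (L : ℝ) ^ 2 *
          ((L : ℝ) ^ 2 * ((1 / (β * (L : ℝ) ^ 2)) ^ 2 * (2 * β / Λ)) +
            ((N : ℝ) * s₀ / 4) ^ 4 *
              ((L : ℝ) ^ 2 * ((1 / (β * (L : ℝ) ^ 2)) ^ 2 * (2 * Real.pi / β) ^ 4 * (4 * B₂ + 6 * B₁ + 2) ^ 2 *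
                  (64 * ((2 / Λ) ^ 4 * (2 * β / Λ)) + (2 / Λ) ^ 6 * (64 * Real.pi))) +
                4 * ((L : ℝ) ^ 2 * (4 * ((1 / (β * (L : ℝ) ^ 2)) ^ 2 * ((β * (L : ℝ) ^ 2) * (β / (Real.pi * (2 * M - 3)))))) ^ 2)) +
            2 * (((L : ℝ) / 4) ^ 4 *
              ((L : ℝ) ^ 2 * ((1 / (β * (L : ℝ) ^ 2)) ^ 2 * (2 * Real.pi / L) ^ 4 *
                (D ^ 2 * (4 * B₂ + 6 * B₁ + 2) * (2 / Λ) + D * (2 * B₁ + 1)) ^ 2 * ((2 / Λ) ^ (2 * 1) * (2 * β / Λ))))))) := by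
  have hL : (0 : ℝ) < L := by exact_mod_cast Nat.pos_of_ne_zero (NeZero.ne L)
  have hNpos : (0 : ℝ) < N := by exact_mod_cast Nat.pos_of_ne_zero (NeZero.ne N)
  set G := gridSymbol L M N β (uvSymbolCT L M β μ K Λ) σ with hG
  set cT : ℝ := ((N : ℝ) * s₀ / 4) ^ 4 with hcT
  set cX : ℝ := ((L : ℝ) / 4) ^ 4 with hcX
  -- weighted Plancherel on the product torus with two differences
  have hP := sum_sum_norm_prodChar_le (d₁ := 1) (L₁ := N) (d₂ := 2) (L₂ := L) (univ : Finset (Fin 2))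
    (fun _ : Fin 1 => (1 : ZMod N)) cT (by positivity) (fun l : Fin 2 => (Pi.single l (1 : ZMod L) : TorusSite 2 L))
    (fun _ => cX) (fun _ _ => by positivity) 2 G
  refine hP.trans (mul_le_mul ?_ ?_ (Real.sqrt_nonneg _) (Real.sqrt_nonneg _))
  · -- the weight sum
    refine Real.sqrt_le_sqrt ?_
    have hW := sum_inv_additiveWeight_le (N := N) (L := L) hs₀ (fun _ : Fin 2 => (1 : ℝ)) (fun _ => one_pos)
    have hrw : ∀ (a : TorusSite 1 N) (b : TorusSite 2 L),
        (1 + cT * (4 * |((∑ j, (fun _ : Fin 1 => (1 : ZMod N)) j * a j).valMinAbs : ℝ)| / N) ^ (2 * 2) +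
            ∑ i ∈ (univ : Finset (Fin 2)), cX * (4 * |((∑ j, (Pi.single i (1 : ZMod L) : TorusSite 2 L) j * b j).valMinAbs : ℝ)| / L) ^ (2 * 2))⁻¹ =
          (1 + (s₀ * |(((a 0).valMinAbs : ℤ) : ℝ)|) ^ 4 + ∑ i, ((fun _ : Fin 2 => (1 : ℝ)) i * |(((b i).valMinAbs : ℤ) : ℝ)|) ^ 4)⁻¹ := by
      intro a b
      have h1 : (∑ j, (fun _ : Fin 1 => (1 : ZMod N)) j * a j) = a 0 := by simp
      have h2 : ∀ i : Fin 2, (∑ j, (Pi.single i (1 : ZMod L) : TorusSite 2 L) j * b j) = b i := by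
        intro i; simp [Pi.single_apply]
      simp_rw [h1, h2]
      congr 1
      congr 1
      · congr 1
        rw [hcT, ← mul_pow]
        congr 1
        field_simp
      · refine sum_congr rfl fun i _ => ?_
        rw [hcX, ← mul_pow, one_mul]
        congr 1
        field_simp
    simp_rw [hrw]
    refine hW.trans (le_of_eq ?_)
    norm_num [Fin.prod_univ_two]
  · -- the three ℓ² sums
    refine Real.sqrt_le_sqrt (mul_le_mul_of_nonneg_left ?_ (by positivity))
    refine add_le_add (add_le_add ?_ ?_) ?_
    · exact sum_norm_sq_gridSymbol_uvSymbolCT_le hβ hΛ hMN σ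
    · exact mul_le_mul_of_nonneg_left (sum_norm_sq_fwdDiff_two_time_uvSymbolCT_le hβ hΛ hB₁ hB₂ hM hMN σ) (by positivity)
    · rw [Fin.sum_univ_two, two_mul]
      exact add_le_add
        (mul_le_mul_of_nonneg_left (sum_norm_sq_fwdDiff_two_space_uvSymbolCT_le hβ hΛ hB₁ hB₂ hD hline hMN σ 0) (by positivity))
        (mul_le_mul_of_nonneg_left (sum_norm_sq_fwdDiff_two_space_uvSymbolCT_le hβ hΛ hB₁ hB₂ hD hline hMN σ 1) (by positivity))

/-- **The decay constant, rows** (`hrow` of `sum_norm_kernel_effAction_le_of_gramBounded` for the scale-`0` covariance on the grid):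
`Σ_Y ‖(Sᵀ C^K_{>Λ} S) X Y‖ ≤ √((2+12/s₀)·14²) · √(N·L²·[ℓ²-terms])` for every grid leg `X`, every `s₀ > 0`, uniformly in `μ`, `σ`;
`0 < β`, `0 < Λ`, `2 ≤ M`, `2M ≤ N`, the frame band's line bound `D`. [cite: PedraSalmhofer2008, §4 Cor. 4.4] -/
theorem rowSum_gridSub_hubbardCovAboveCT_le {β μ Λ : ℝ} {K : TrigPolyC4v} (hβ : 0 < β) (hΛ : 0 < Λ) {B₁ B₂ : ℝ}
    (hB₁ : ∀ x, |deriv salmhoferCutoff x| ≤ B₁) (hB₂ : ∀ x, |deriv (deriv salmhoferCutoff) x| ≤ B₂) {D : ℝ} (hD : 0 ≤ D)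
    (hline : UVLineBound μ K D) (hM : 2 ≤ M) (hMN : 2 * M ≤ N) {s₀ : ℝ} (hs₀ : 0 < s₀) (X : GridLeg (GridPoint L N)) :
    ∑ Y : GridLeg (GridPoint L N),
        ‖((hubbardGridSub L M β N).transpose * hubbardCovAboveCT L M β μ 0 K Λ * hubbardGridSub L M β N) X Y‖ ≤
      Real.sqrt ((2 + 12 / s₀) * 14 ^ 2) *
        Real.sqrt ((N : ℝ) ^ 1 * (L : ℝ) ^ 2 *
          ((L : ℝ) ^ 2 * ((1 / (β * (L : ℝ) ^ 2)) ^ 2 * (2 * β / Λ)) +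
            ((N : ℝ) * s₀ / 4) ^ 4 *
              ((L : ℝ) ^ 2 * ((1 / (β * (L : ℝ) ^ 2)) ^ 2 * (2 * Real.pi / β) ^ 4 * (4 * B₂ + 6 * B₁ + 2) ^ 2 *
                  (64 * ((2 / Λ) ^ 4 * (2 * β / Λ)) + (2 / Λ) ^ 6 * (64 * Real.pi))) +
                4 * ((L : ℝ) ^ 2 * (4 * ((1 / (β * (L : ℝ) ^ 2)) ^ 2 * ((β * (L : ℝ) ^ 2) * (β / (Real.pi * (2 * M - 3)))))) ^ 2)) +
            2 * (((L : ℝ) / 4) ^ 4 *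
              ((L : ℝ) ^ 2 * ((1 / (β * (L : ℝ) ^ 2)) ^ 2 * (2 * Real.pi / L) ^ 4 *
                (D ^ 2 * (4 * B₂ + 6 * B₁ + 2) * (2 / Λ) + D * (2 * B₁ + 1)) ^ 2 * ((2 / Λ) ^ (2 * 1) * (2 * β / Λ))))))) := by
  rw [hubbardCovAboveCT_zero_seed_eq_normalCovariance_uvSymbolCT]
  exact sum_norm_gridSub_pullback_row_le hβ.ne' hMN _
    (fun σ => sum_sum_norm_charSum_gridSymbol_uvSymbolCT_le hβ hΛ hB₁ hB₂ hD hline hM hMN hs₀ σ) X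

/-- **The decay constant, columns** (`hcol`): the same bound for `Σ_X ‖(Sᵀ C^K_{>Λ} S) X Y‖`. [cite: PedraSalmhofer2008, §4 Cor. 4.4] -/
theorem colSum_gridSub_hubbardCovAboveCT_le {β μ Λ : ℝ} {K : TrigPolyC4v} (hβ : 0 < β) (hΛ : 0 < Λ) {B₁ B₂ : ℝ}
    (hB₁ : ∀ x, |deriv salmhoferCutoff x| ≤ B₁) (hB₂ : ∀ x, |deriv (deriv salmhoferCutoff) x| ≤ B₂) {D : ℝ} (hD : 0 ≤ D)
    (hline : UVLineBound μ K D) (hM : 2 ≤ M) (hMN : 2 * M ≤ N) {s₀ : ℝ} (hs₀ : 0 < s₀) (Y : GridLeg (GridPoint L N)) :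
    ∑ X : GridLeg (GridPoint L N),
        ‖((hubbardGridSub L M β N).transpose * hubbardCovAboveCT L M β μ 0 K Λ * hubbardGridSub L M β N) X Y‖ ≤
      Real.sqrt ((2 + 12 / s₀) * 14 ^ 2) *
        Real.sqrt ((N : ℝ) ^ 1 * (L : ℝ) ^ 2 *
          ((L : ℝ) ^ 2 * ((1 / (β * (L : ℝ) ^ 2)) ^ 2 * (2 * β / Λ)) +
            ((N : ℝ) * s₀ / 4) ^ 4 *
              ((L : ℝ) ^ 2 * ((1 / (β * (L : ℝ) ^ 2)) ^ 2 * (2 * Real.pi / β) ^ 4 * (4 * B₂ + 6 * B₁ + 2) ^ 2 *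
                  (64 * ((2 / Λ) ^ 4 * (2 * β / Λ)) + (2 / Λ) ^ 6 * (64 * Real.pi))) +
                4 * ((L : ℝ) ^ 2 * (4 * ((1 / (β * (L : ℝ) ^ 2)) ^ 2 * ((β * (L : ℝ) ^ 2) * (β / (Real.pi * (2 * M - 3)))))) ^ 2)) +
            2 * (((L : ℝ) / 4) ^ 4 *
              ((L : ℝ) ^ 2 * ((1 / (β * (L : ℝ) ^ 2)) ^ 2 * (2 * Real.pi / L) ^ 4 *
                (D ^ 2 * (4 * B₂ + 6 * B₁ + 2) * (2 / Λ) + D * (2 * B₁ + 1)) ^ 2 * ((2 / Λ) ^ (2 * 1) * (2 * β / Λ))))))) := by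
  rw [hubbardCovAboveCT_zero_seed_eq_normalCovariance_uvSymbolCT]
  exact sum_norm_gridSub_pullback_col_le hβ.ne' hMN _
    (fun σ => sum_sum_norm_charSum_gridSymbol_uvSymbolCT_le hβ hΛ hB₁ hB₂ hD hline hM hMN hs₀ σ) Y

end Literature.MathematicalPhysics.QuantumLattice

end
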